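import Literature.AnabelianGeometry.SemiGraphs.TemperedCompletionRestrict
import Literature.AnabelianGeometry.AbsoluteAnabelian.ZHatCompletionFreeProcyclic
import Literature.AnabelianGeometry.AbsoluteAnabelian.AbsTopIThm26iProofs
import Mathlib.GroupTheory.DoubleCoset
import HarnessLib

/-!
# The tempered curve attached to an open subgroup of finite index: `X_H → X_K` ([SemiAnbd] §6)

Mochizuki, *Semi-graphs of anabelioids*, Publ. RIMS **42** (2006) [SemiAnbd], §6 p. 69 ("a hyperbolic curve `X_K`
… `Π^temp_{X_K}` … fits into a natural exact sequence"; p. 70, proof of Lem. 6.3 (ii): "replacing `F` by an open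
subgroup of `F` of finite index", i.e. passing to the finite étale covering it classifies), p. 71 ("`x` determines, up
to conjugation … a decomposition group `D_x ⊆ Π^temp_{X_K}`"; "`I_x := D_x ∩ Δ^temp_X` is isomorphic to `Ẑ(1)`").
[cite: MochizukiSemiAnbd2006, §6 pp.69-71]

DEF-BEARING adapter (abc-iut cell; post-freeze def, reading (ii); staged by the MERGE-MAP seat abc-iut-L6-t7 gen 3 as
«B15 piece 1» for abc-iut-L3's disposal — HOME/staging/L6/L6-t7/B15-SHAPES.md): for abc-iut-L3's interface
`X : TemperedCurve p` and an OPEN subgroup `H ≤ Π^temp_{X_K}` of FINITE INDEX (classically: a connected finite étale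
covering `X_H → X_K`, [SGA1]), the tempered-curve datum OF THE COVERING, `TemperedCurve.ofOpenSubgroup`:
`Π^temp := H`; `Π̂ :=` the closure of `H` in `Π_{X_K}` ("closure = completion", abc-iut-L2-d1's
`IsProfiniteCompletion.exists_restrict_of_isOpen_of_finiteIndex`); base field `K'` with `aug(H) = G_{K'}` (a PARAMETER
with its law — for the coverings `X̲_v → X_v` of [IUTchI] Def 3.1 (e) one takes `K' = K`); closed points of the
compactification of `X_H` over a closed point `x` of `X̄_K` := the double cosets `H \ Π^temp_{X_K} / D_x`, with
decomposition groups `D_y = H ∩ g D_x g⁻¹` and inertia groups `I_y = H ∩ g I_x g⁻¹` — an OPEN subgroup of `g I_x g⁻¹ ≅ Ẑ`,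
hence `≅ Ẑ` («open subgroups of `Ẑ` are `≅ Ẑ`»: abc-iut-L4's `FundamentalExtension.IsFreeProcyclic.subgroup_of_isOpen` +
`isFreeProcyclic_iff_nonempty_continuousMulEquiv_zHatCompletion`, classical profinite group theory — no [AbsTop] content
is used). ONE printed property is carried as a HYPOTHESIS, named: `hDopen` ("`D_y` surjects onto an open subgroup of
`G_{K'}`", p. 71) — the interface records `D_x` closed but not compact, so openness of `aug(H ∩ gD_xg⁻¹)` does not follow
from the fields alone; it DOES follow from compactness of the `D_x` (abc-iut-L3's `Thm68Sub.DecompCompact`, a theorem under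
`GroupLevelData`) — proof-only companion `TemperedCurveOfOpenSubgroupCompact.lean` (`hDopen_of_isCompact_decomp`). PURPOSE (MERGE-MAP candidate row B15): the tempered-curve structure on `X̲_v` over which abc-iut-L5's
GENUINE [IUTchI] §2 datum `StableCurveTemperedData.ofSpecialFibre` can be formed, to be compared with the `±`-tower
`PlusMinusTower.ofPiCHat` of [IUTchII] Def. 2.3 (i) (abc-iut-L6-t19, p430122). Nothing here takes a side on
[IUTchIII] Cor. 3.12; constructed ≠ the paper's reconstruction algorithms.
-/

noncomputable section

namespace Literature.AnabelianGeometry.SemiGraphs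

open _root_.Topology
open scoped Pointwise

namespace TemperedCurve

variable {p : ℕ} [Fact p.Prime] (X : TemperedCurve p) (H : Subgroup X.PiTemp)

/-! ### The closure of `H` in `Π_{X_K}` is the profinite completion of `H` -/

/-- `Π̂_H :=` the closure of (the image of) `H` in `Π_{X_K}` ([SemiAnbd] §6 p. 69 "the `∧` denotes profinite
completion, or, equivalently, closure in `Π_{X_K}`"). [cite: MochizukiSemiAnbd2006, §6 p.69] -/
def hatOfOpen : Subgroup X.PiHat := (H.map X.toHat.toMonoidHom).topologicalClosure

/-- `H → Π̂_H`, the restriction of `Π^temp_{X_K} → Π_{X_K}`. [cite: MochizukiSemiAnbd2006, §6 p.69] -/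
def toHatOfOpen : H →ₜ* X.hatOfOpen H where
  toMonoidHom := (X.toHat.toMonoidHom.comp H.subtype).codRestrict (X.hatOfOpen H) fun h =>
    Subgroup.le_topologicalClosure _ ⟨h, h.2, rfl⟩
  continuous_toFun := (X.toHat.continuous.comp continuous_subtype_val).subtype_mk _

/-- Values of `toHatOfOpen`. [cite: MochizukiSemiAnbd2006, §6 p.69] -/
@[simp] theorem coe_toHatOfOpen (h : H) : ((X.toHatOfOpen H h : X.hatOfOpen H) : X.PiHat) = X.toHat h := rfl

/-- **"closure = completion"**: for `H` open of finite index, `H → Π̂_H` IS a profinite completion (abc-iut-L2-d1's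
`IsProfiniteCompletion.exists_restrict_of_isOpen_of_finiteIndex`, whose ∃-witness is determined by its values).
[cite: MochizukiSemiAnbd2006, §6 p.69] -/
theorem isProfiniteCompletion_toHatOfOpen (hHo : IsOpen (H : Set X.PiTemp)) [H.FiniteIndex] :
    IsProfiniteCompletion (X.toHatOfOpen H) := by
  obtain ⟨ιU, hval, hcomp⟩ :=
    X.isProfiniteCompletion_toHat.exists_restrict_of_isOpen_of_finiteIndex H hHo
  have hEq : ιU = X.toHatOfOpen H := by
    ext u
    exact hval u
  rw [← hEq]
  exact hcomp

/-- `H → Π̂_H` is injective ("natural injection", p. 69). [cite: MochizukiSemiAnbd2006, §6 p.69] -/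
theorem toHatOfOpen_injective : Function.Injective (X.toHatOfOpen H) := by
  intro a b h
  have h' : X.toHat a = X.toHat b := by
    simpa using congrArg (fun z : X.hatOfOpen H => (z : X.PiHat)) h
  exact Subtype.ext (X.toHat_injective h')

/-! ### Decomposition groups of the covering -/

/-- The closed points of the compactification of `X_H` lying over the closed point `x` of `X̄_K`: the double cosets
`H \ Π^temp_{X_K} / D_x` (classical covering theory). [cite: MochizukiSemiAnbd2006, §6 p.71] -/
def PtOfOpen : Type := Σ x : X.Pt, DoubleCoset.Quotient (H : Set X.PiTemp) (X.decomp x : Set X.PiTemp)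

/-- A representative `g ∈ Π^temp_{X_K}` of the double coset of a point of `X_H`. [cite: MochizukiSemiAnbd2006, §6 p.71] -/
def repOfOpen (y : X.PtOfOpen H) : X.PiTemp := y.2.out

/-- Conjugation `h ↦ g⁻¹ h g` restricted to `H`, as a monoid homomorphism `H → Π^temp_{X_K}` (used to pull `D_x` back to
`H ∩ g D_x g⁻¹`). [cite: MochizukiSemiAnbd2006, §6 p.71] -/
def conjInvRestrict (g : X.PiTemp) : H →* X.PiTemp := (MulAut.conj g⁻¹).toMonoidHom.comp H.subtype

/-- Value of `conjInvRestrict`: `h ↦ g⁻¹ h g`. [cite: MochizukiSemiAnbd2006, §6 p.71] -/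
theorem conjInvRestrict_apply (g : X.PiTemp) (h : H) : X.conjInvRestrict H g h = g⁻¹ * h * g⁻¹⁻¹ := rfl

/-- `conjInvRestrict` is continuous. [cite: MochizukiSemiAnbd2006, §6 p.71] -/
theorem continuous_conjInvRestrict (g : X.PiTemp) : Continuous (X.conjInvRestrict H g) := by
  change Continuous fun h : H => g⁻¹ * (h : X.PiTemp) * g⁻¹⁻¹
  exact (continuous_const.mul continuous_subtype_val).mul continuous_const

/-- The decomposition group in `H = Π^temp_{X_H}` of the point of `X_H` with double coset `H g D_x`: `D_y = H ∩ g D_x g⁻¹`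
(as a subgroup of `H`: the elements `h` with `g⁻¹ h g ∈ D_x`). [cite: MochizukiSemiAnbd2006, §6 p.71] -/
def decompOfOpenAt (x : X.Pt) (g : X.PiTemp) : Subgroup H := (X.decomp x).comap (X.conjInvRestrict H g)

/-- Membership in `D_y`. [cite: MochizukiSemiAnbd2006, §6 p.71] -/
theorem mem_decompOfOpenAt {x : X.Pt} {g : X.PiTemp} {h : H} :
    h ∈ X.decompOfOpenAt H x g ↔ g⁻¹ * (h : X.PiTemp) * g⁻¹⁻¹ ∈ X.decomp x := Iff.rfl

/-- `D_y` is closed (`D_x` is closed and `h ↦ g⁻¹ h g` continuous). [cite: MochizukiSemiAnbd2006, §6 p.71] -/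
theorem isClosed_decompOfOpenAt (x : X.Pt) (g : X.PiTemp) : IsClosed (X.decompOfOpenAt H x g : Set H) :=
  (X.isClosed_decomp x).preimage (X.continuous_conjInvRestrict H g)

/-- The augmentation of the covering: `Π^temp_{X_H} = H → G_{ℚ_p}`. [cite: MochizukiSemiAnbd2006, §6 p.69] -/
def augOfOpen : H →ₜ* GQp p := X.aug.comp (ContinuousMonoidHom.mk H.subtype continuous_subtype_val)

/-- Values of `augOfOpen`. [cite: MochizukiSemiAnbd2006, §6 p.69] -/
@[simp] theorem augOfOpen_apply (h : H) : X.augOfOpen H h = X.aug h := rfl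

/-- For a NON-cusp `x`, the inertia group `D_y ∩ Δ^temp_{X_H}` of a point over `x` is trivial (because `I_x = 1` and
`Δ` is normal). [cite: MochizukiSemiAnbd2006, §6 p.71] -/
theorem decompOfOpenAt_inf_ker_eq_bot {x : X.Pt} (hx : ¬ X.IsCusp x) (g : X.PiTemp) :
    X.decompOfOpenAt H x g ⊓ (X.augOfOpen H).toMonoidHom.ker = ⊥ := by
  rw [eq_bot_iff]
  rintro h ⟨hD, hker⟩
  rw [Subgroup.mem_bot]
  have hker' : X.aug (h : X.PiTemp) = 1 := by simpa [MonoidHom.mem_ker] using hker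
  have haug : X.aug (g⁻¹ * (h : X.PiTemp) * g⁻¹⁻¹) = 1 := by
    rw [map_mul, map_mul, hker', mul_one, ← map_mul, inv_inv, inv_mul_cancel, map_one]
  have hI : g⁻¹ * (h : X.PiTemp) * g⁻¹⁻¹ ∈ X.decomp x ⊓ X.aug.toMonoidHom.ker :=
    Subgroup.mem_inf.mpr ⟨hD, MonoidHom.mem_ker.mpr haug⟩
  rw [X.inertia_eq_bot x hx, Subgroup.mem_bot] at hI
  have : (h : X.PiTemp) = 1 := by
    have := congrArg (fun z => g * z * g⁻¹) hI
    simpa [mul_assoc] using this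
  exact Subtype.ext this

/-! ### Inertia groups of the covering are `≅ Ẑ` -/

/-- The conjugate `g I_x g⁻¹` of the inertia group of a cusp, pulled back along `h ↦ g⁻¹ h g`.
[cite: MochizukiSemiAnbd2006, §6 p.71] -/
def conjInertia (x : X.Pt) (g : X.PiTemp) : Subgroup X.PiTemp :=
  (X.decomp x ⊓ X.aug.toMonoidHom.ker).comap (MulAut.conj g⁻¹).toMonoidHom

/-- Membership in `g I_x g⁻¹`. [cite: MochizukiSemiAnbd2006, §6 p.71] -/
theorem mem_conjInertia_iff {x : X.Pt} {g y : X.PiTemp} :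
    y ∈ X.conjInertia x g ↔ g⁻¹ * y * g⁻¹⁻¹ ∈ X.decomp x ⊓ X.aug.toMonoidHom.ker := Iff.rfl

/-- `g I_x g⁻¹ ≃ₜ* I_x` by `h ↦ g⁻¹ h g`. [cite: MochizukiSemiAnbd2006, §6 p.71] -/
def conjInertiaEquiv (x : X.Pt) (g : X.PiTemp) :
    X.conjInertia x g ≃ₜ* ↥(X.decomp x ⊓ X.aug.toMonoidHom.ker) :=
  { toFun := fun h => ⟨g⁻¹ * (h : X.PiTemp) * g⁻¹⁻¹, (X.mem_conjInertia_iff).mp h.2⟩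
    invFun := fun i => ⟨g * (i : X.PiTemp) * g⁻¹, (X.mem_conjInertia_iff).mpr (by
      have hi : g⁻¹ * (g * (i : X.PiTemp) * g⁻¹) * g⁻¹⁻¹ = i := by group
      rw [hi]
      exact i.2)⟩
    left_inv := fun h => Subtype.ext (by simp [mul_assoc])
    right_inv := fun i => Subtype.ext (by simp [mul_assoc])
    map_mul' := fun a b => Subtype.ext (by
      simp only [Subgroup.coe_mul]
      group)
    continuous_toFun := ((continuous_const.mul continuous_subtype_val).mul continuous_const).subtype_mk _
    continuous_invFun := ((continuous_const.mul continuous_subtype_val).mul continuous_const).subtype_mk _ }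

/-- **The inertia group of a point of `X_H` over a cusp is `≅ Ẑ`**: it is `H ∩ g I_x g⁻¹`, an OPEN subgroup of
`g I_x g⁻¹ ≅ I_x ≅ Ẑ` (`H` open), and open subgroups of a free procyclic group are free procyclic (abc-iut-L4
`IsFreeProcyclic.subgroup_of_isOpen`), i.e. `≅ Ẑ` (`isFreeProcyclic_iff_nonempty_continuousMulEquiv_zHatCompletion`).
[cite: MochizukiSemiAnbd2006, §6 p.71] -/
theorem nonempty_inertiaOfOpen_equiv_zHat (hHo : IsOpen (H : Set X.PiTemp)) {x : X.Pt} (hx : X.IsCusp x)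
    (g : X.PiTemp) :
    Nonempty (↥(X.decompOfOpenAt H x g ⊓ (X.augOfOpen H).toMonoidHom.ker) ≃ₜ* ZHat) := by
  classical
  obtain ⟨eI⟩ := X.inertia_equiv_zHat x hx
  -- `J := g I_x g⁻¹ ≃ₜ* Ẑ`
  let J : Subgroup X.PiTemp := X.conjInertia x g
  let eJ : J ≃ₜ* ZHat := (X.conjInertiaEquiv x g).trans eI
  haveI : CompactSpace J := eJ.toHomeomorph.symm.compactSpace
  haveI : T2Space J := eJ.toHomeomorph.symm.t2Space
  haveI : TotallyDisconnectedSpace J := eJ.toHomeomorph.symm.totallyDisconnectedSpace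
  have hJ : AbsoluteAnabelian.FundamentalExtension.IsFreeProcyclic J :=
    AbsoluteAnabelian.FundamentalExtension.IsFreeProcyclic.of_continuousMulEquiv_zHatCompletion eJ
  -- `U := H ∩ J`, open in `J`
  let U : Subgroup J := H.subgroupOf J
  have hUo : IsOpen (U : Set J) := hHo.preimage continuous_subtype_val
  have hU : AbsoluteAnabelian.FundamentalExtension.IsFreeProcyclic U := hJ.subgroup_of_isOpen U hUo
  have hUc : IsClosed (U : Set J) := Subgroup.isClosed_of_isOpen U hUo
  haveI : CompactSpace U := isCompact_iff_compactSpace.mp hUc.isCompact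
  obtain ⟨eU⟩ := hU.nonempty_continuousMulEquiv_zHatCompletion
  -- the inertia group of the covering IS `U`, as topological groups
  let T : Subgroup H := X.decompOfOpenAt H x g ⊓ (X.augOfOpen H).toMonoidHom.ker
  have hTJ : ∀ t : T, ((t : H) : X.PiTemp) ∈ J := by
    intro t
    have hD : g⁻¹ * ((t : H) : X.PiTemp) * g⁻¹⁻¹ ∈ X.decomp x := (Subgroup.mem_inf.mp t.2).1
    have hk : X.aug ((t : H) : X.PiTemp) = 1 := (MonoidHom.mem_ker).mp (Subgroup.mem_inf.mp t.2).2
    have haug : X.aug (g⁻¹ * ((t : H) : X.PiTemp) * g⁻¹⁻¹) = 1 := by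
      rw [map_mul, map_mul, hk, mul_one, ← map_mul, inv_inv, inv_mul_cancel, map_one]
    exact (X.mem_conjInertia_iff).mpr (Subgroup.mem_inf.mpr ⟨hD, MonoidHom.mem_ker.mpr haug⟩)
  let φ : T ≃ₜ* U :=
    { toFun := fun t => ⟨⟨((t : H) : X.PiTemp), hTJ t⟩, by
        change ((⟨((t : H) : X.PiTemp), hTJ t⟩ : J) : X.PiTemp) ∈ H
        exact (t : H).2⟩
      invFun := fun u => ⟨⟨((u : J) : X.PiTemp), u.2⟩, by
        have hJu : ((u : J) : X.PiTemp) ∈ J := (u : J).2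
        rw [mem_conjInertia_iff, Subgroup.mem_inf, MonoidHom.mem_ker] at hJu
        refine Subgroup.mem_inf.mpr ⟨hJu.1, MonoidHom.mem_ker.mpr ?_⟩
        change X.aug ((u : J) : X.PiTemp) = 1
        have h2 : X.aug (g⁻¹ * ((u : J) : X.PiTemp) * g⁻¹⁻¹) = 1 := hJu.2
        rw [map_mul, map_mul, inv_inv] at h2
        -- `a⁻¹ * b * a = 1 ⇒ b = 1`
        have h3 : X.aug ((u : J) : X.PiTemp) =
            X.aug g * (X.aug g⁻¹ * X.aug ((u : J) : X.PiTemp) * X.aug g) * X.aug g⁻¹ := by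
          rw [map_inv]; group
        rw [h3, h2, mul_one, ← map_mul, mul_inv_cancel, map_one]⟩
      left_inv := fun t => by ext; rfl
      right_inv := fun u => by ext; rfl
      map_mul' := fun a b => by ext; rfl
      continuous_toFun := by
        apply Continuous.subtype_mk
        apply Continuous.subtype_mk
        exact continuous_subtype_val.comp continuous_subtype_val
      continuous_invFun := by
        apply Continuous.subtype_mk
        apply Continuous.subtype_mk
        exact continuous_subtype_val.comp continuous_subtype_val }
  exact ⟨φ.trans eU⟩

/-! ### The tempered curve `X_H` -/

/-- **The tempered-curve datum of the finite étale covering `X_H → X_K` classified by an open subgroup `H ≤ Π^temp_{X_K}`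
of finite index** ([SemiAnbd] §6 pp. 69–71; SGA1): `Π^temp := H`, `Π̂ := closure of H in Π_{X_K}` (= its profinite
completion), base field `K'` with `aug(H) = G_{K'}` (parameter + law `hK'`), points over `x` := `H \ Π^temp_{X_K} / D_x`,
`D_y := H ∩ g D_x g⁻¹`, `I_y := H ∩ g I_x g⁻¹ ≅ Ẑ`. The printed property "`D_y` surjects onto an open subgroup of `G_{K'}`"
is the HYPOTHESIS `hDopen` (not derivable from the interface, which records `D_x` closed only).
[cite: MochizukiSemiAnbd2006, §6 pp.69-71] -/
def ofOpenSubgroup (hHo : IsOpen (H : Set X.PiTemp)) [H.FiniteIndex]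
    (K' : IntermediateField ℚ_[p] (AlgebraicClosure ℚ_[p])) [FiniteDimensional ℚ_[p] K']
    (hK' : (X.aug.toMonoidHom.comp H.subtype).range = K'.fixingSubgroup)
    (hDopen : ∀ (x : X.Pt) (g : X.PiTemp), IsOpen (X.aug '' ((X.decompOfOpenAt H x g).map H.subtype : Set X.PiTemp))) :
    TemperedCurve p where
  K := K'
  finiteDimensional_K := inferInstance
  PiTemp := H
  aug := X.augOfOpen H
  range_aug := hK'
  PiHat := X.hatOfOpen H
  toHat := X.toHatOfOpen H
  isProfiniteCompletion_toHat := X.isProfiniteCompletion_toHatOfOpen H hHo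
  toHat_injective := X.toHatOfOpen_injective H
  augHat := X.augHat.comp (ContinuousMonoidHom.mk (X.hatOfOpen H).subtype continuous_subtype_val)
  augHat_comp g := X.augHat_comp g
  Pt := X.PtOfOpen H
  IsCusp y := X.IsCusp y.1
  decomp y := X.decompOfOpenAt H y.1 (X.repOfOpen H y)
  isClosed_decomp y := X.isClosed_decompOfOpenAt H y.1 _
  isOpen_aug_decomp y := by
    have := hDopen y.1 (X.repOfOpen H y)
    convert this using 1
    ext σ
    simp only [Set.mem_image, SetLike.mem_coe, Subgroup.mem_map, augOfOpen_apply]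
    constructor
    · rintro ⟨h, hh, rfl⟩
      exact ⟨h, ⟨h, hh, rfl⟩, rfl⟩
    · rintro ⟨_, ⟨h, hh, rfl⟩, rfl⟩
      exact ⟨h, hh, rfl⟩
  inertia_eq_bot y hy := X.decompOfOpenAt_inf_ker_eq_bot H hy _
  inertia_equiv_zHat y hy := X.nonempty_inertiaOfOpen_equiv_zHat H hHo hy _

section API

variable (hHo : IsOpen (H : Set X.PiTemp)) [H.FiniteIndex]
  (K' : IntermediateField ℚ_[p] (AlgebraicClosure ℚ_[p])) [FiniteDimensional ℚ_[p] K']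
  (hK' : (X.aug.toMonoidHom.comp H.subtype).range = K'.fixingSubgroup)
  (hDopen : ∀ (x : X.Pt) (g : X.PiTemp), IsOpen (X.aug '' ((X.decompOfOpenAt H x g).map H.subtype : Set X.PiTemp)))

/-- The fields of `ofOpenSubgroup`, for rewriting (`rfl`). [cite: MochizukiSemiAnbd2006, §6 pp.69-71] -/
theorem ofOpenSubgroup_PiTemp : (X.ofOpenSubgroup H hHo K' hK' hDopen).PiTemp = H := rfl

/-- `Π̂_{X_H}` is the closure of `H` in `Π_{X_K}` (`rfl`). [cite: MochizukiSemiAnbd2006, §6 p.69] -/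
theorem ofOpenSubgroup_PiHat : (X.ofOpenSubgroup H hHo K' hK' hDopen).PiHat = X.hatOfOpen H := rfl

/-- The augmentation of `X_H` is the restriction of that of `X_K` (`rfl`). [cite: MochizukiSemiAnbd2006, §6 p.69] -/
theorem ofOpenSubgroup_aug_apply (h : H) : (X.ofOpenSubgroup H hHo K' hK' hDopen).aug h = X.aug h := rfl

/-- `Δ^temp_{X_H} = H ∩ Δ^temp_X` (pulled back to `H`). [cite: MochizukiSemiAnbd2006, §6 p.69] -/
theorem ofOpenSubgroup_DeltaTemp :
    (X.ofOpenSubgroup H hHo K' hK' hDopen).DeltaTemp = X.DeltaTemp.comap H.subtype := by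
  ext h
  rfl

/-- The decomposition groups of `X_H` (`rfl`). [cite: MochizukiSemiAnbd2006, §6 p.71] -/
theorem ofOpenSubgroup_decomp (y : X.PtOfOpen H) :
    (X.ofOpenSubgroup H hHo K' hK' hDopen).decomp y = X.decompOfOpenAt H y.1 (X.repOfOpen H y) := rfl

/-- The inertia groups of `X_H`: `I_y = H ∩ g I_x g⁻¹` read in `H`. [cite: MochizukiSemiAnbd2006, §6 p.71] -/
theorem mem_ofOpenSubgroup_inertia_iff (y : X.PtOfOpen H) (h : H) :
    h ∈ (X.ofOpenSubgroup H hHo K' hK' hDopen).inertia y ↔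
      (X.repOfOpen H y)⁻¹ * (h : X.PiTemp) * (X.repOfOpen H y)⁻¹⁻¹ ∈ X.decomp y.1 ∧ X.aug h = 1 := by
  change h ∈ X.decompOfOpenAt H y.1 (X.repOfOpen H y) ⊓ (X.augOfOpen H).toMonoidHom.ker ↔ _
  rw [Subgroup.mem_inf, mem_decompOfOpenAt, MonoidHom.mem_ker]
  rfl

end API

end TemperedCurve

end Literature.AnabelianGeometry.SemiGraphs

end
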